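import Summits.MatrixMultiplication.MatrixMultiplication.Theorems.SubgroupIdentityDesigns.Negative.ReflectedTranslation

/-!
# Dihedral times a root group: the third order-`2p²` non-carrier in the member window
(cell B2b-5, gen 21)

VALUE = THEOREM on the level-one slice of `SubgroupIdentityDesigns` — NOT summit progress; the crux
(`stmt-MatrixMultiplication-14079`) is untouched.

`m = 3`, all odd `p`, every `ε`, no TPP.  Let `N = E₁₂ + E₂₃` (so `J₃ = exp N`), `E = E₁₃` (the
highest root; `N E = E N = 0`) and `A = {A(t,c) = exp(tN + cE)}` — an ELEMENTARY ABELIAN group of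
order `p²` containing both transvections (`X₁₃ = exp(cE)`) and regular unipotents; let
`s' = diag(1,-1,1)`, which inverts `exp(tN)` and centralises `X₁₃`.  The group
`K = A ⋊ ⟨s'⟩ = (⟨J₃⟩ ⋊ ⟨s'⟩) × X₁₃ ≅ D_{2p} × C_p` consists of the matrices
`M(t,c,e) = A(t,c)·diag(1,e,1) = [[1, e t, t²/2 + c],[0, e, t],[0, 0, 1]]` (`e = ±1`), has order `2p²`
— IN THE MEMBER WINDOW — and is the order-`50` minimal non-carrier class with `9` mirrors and `11`
orbits of the GAP catalogue at `(3,5)` (ORACLE-g21 §G21-10b/§G21-24, kit j144577); its failing linear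
characters are `σ(M(t,c,(-1)^j)) = (-1)^j ψ(λc)`, `λ ≠ 0` (`p - 1 = 4` of them).  Both `D_{2p} = ⟨J₃, s'⟩`
and `A` are carriers, and so is `(⟨J₃⟩ × {±1}) ⋊ ⟨s⟩` without `-1` (`DihedralUnipotent`): here the
root group `X₁₃` plays the part of `-1`.

THE FUNCTIONAL (character-free): `L h = Σ_{t,c} Σ_{j<2} (-1)^j ψ(c) h(M(t,c,(-1)^j))` kills every
vector transport `g ↦ [g u = w]`:  if `u₂ = 0` the condition does not see `c` and `Σ_c ψ(c) = 0`;
if `u₂ ≠ 0` the SHIFT `t ↦ t + 2u₁/u₂` carries the solutions for `j = 0` onto those for `j = 1` with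
the same `c` (`M(t + 2u₁/u₂, c, -1) u = M(t, c, 1) u`), so the two signs cancel.  On an identity test
covering `K ∖ 1`, `L = 1`.  Consequences: `K` lies in NO MEMBER (`no_design_same₁`); `D_{2p}` in one
member with `X₁₃` in another is excluded too (`no_design_DX₁₂`, `no_design_XD₁₂`, `no_design_DX₁₃`).
Multiplication law: `M(t,c,e) M(t',c',e') = M(t + e t', c + c', e e')` (`e² = 1`).
-/

open scoped BigOperators Classical Matrix

set_option linter.dupNamespace false

noncomputable section

namespace Summit.MatrixMultiplication.MatrixMultiplication.Theorems.SubgroupIdentityDesigns.Negative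
namespace DihedralRoot

open Summit.MatrixMultiplication.MatrixMultiplication.Theorems.LieRankDesigns.Negative (GLm Mat)
open Summit.MatrixMultiplication.MatrixMultiplication.Theorems.LevelOneGL2Designs.Negative
open PackingBridge (exists_test)
open VectorTransportSpan (levelSubmodule_le_of_transport)
open DihedralUnipotent (neg_one_ne_one two_mul_inv_two)
open ReflectedTranslation (sg sg_mul_sg sum_sign sum_psi vec3_eta)

variable {p : ℕ} [hp : Fact p.Prime]

/-! ## The elements `M(t,c,e)` -/

/-- `M(t,c,e) = [[1, e t, t²/2 + c],[0, e, t],[0,0,1]]`. -/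
def Mmat (t c e : ZMod p) : Mat p 3 := !![1, e * t, t ^ 2 * 2⁻¹ + c; 0, e, t; 0, 0, 1]

/-- Multiplication law (`e² = 1`, `p` odd). -/
theorem Mmat_mul (hp2 : p ≠ 2) (t c e t' c' e' : ZMod p) (he : e * e = 1) :
    Mmat t c e * Mmat t' c' e' = Mmat (t + e * t') (c + c') (e * e') := by
  have h2 := two_mul_inv_two hp2
  ext i j
  fin_cases i <;> fin_cases j <;> simp [Mmat, Matrix.mul_apply, Fin.sum_univ_three] <;>
    first
    | ring1
    | linear_combination (-(e' * t')) * he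
    | linear_combination (-(t' ^ 2 * 2⁻¹)) * he + (-(t' * e * t)) * h2

/-- `M(0,0,1) = 1`. -/
theorem Mmat_one : Mmat (0 : ZMod p) 0 1 = 1 := by
  ext i j
  fin_cases i <;> fin_cases j <;> simp [Mmat]

/-- `det M(t,c,e) = e`. -/
theorem det_Mmat (t c e : ZMod p) : (Mmat t c e).det = e := by
  rw [Mmat, Matrix.det_fin_three]
  simp

/-- `(-1)^j ≠ 0`. -/
theorem sg_ne_zero (j : ℕ) : sg (p := p) j ≠ 0 :=
  pow_ne_zero _ (neg_ne_zero.mpr one_ne_zero)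

/-- `M(t,c,(-1)^j)` as an element of `GL₃(𝔽_p)`. -/
def MGL (t c : ZMod p) (j : ℕ) : GLm p 3 :=
  Matrix.GeneralLinearGroup.mkOfDetNeZero (Mmat t c (sg j))
    (by rw [det_Mmat]; exact sg_ne_zero j)

/-- Underlying matrix of `MGL`. -/
@[simp] theorem coe_MGL (t c : ZMod p) (j : ℕ) :
    ((MGL t c j : GLm p 3) : Mat p 3) = Mmat t c (sg j) :=
  rfl

/-- `M(0,0,1) = 1` in `GL₃`. -/
theorem MGL_zero : (MGL (0 : ZMod p) 0 0 : GLm p 3) = 1 :=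
  Units.ext (by simp [sg, Mmat_one])

/-- `M(t,c,(-1)^j) u` in coordinates. -/
theorem MGL_mulVec (t c : ZMod p) (j : ℕ) (u : Fin 3 → ZMod p) :
    ((MGL t c j : GLm p 3) : Mat p 3) *ᵥ u =
      ![u 0 + sg j * t * u 1 + (t ^ 2 * 2⁻¹ + c) * u 2, sg j * u 1 + t * u 2, u 2] := by
  ext i
  fin_cases i <;> simp [Mmat, Matrix.mulVec, dotProduct, Fin.sum_univ_three]

/-- `M(t,c,(-1)^j) = 1` (`j < 2`, `p` odd) only for `(t,c,j) = (0,0,0)`. -/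
theorem MGL_eq_one (hp2 : p ≠ 2) {t c : ZMod p} {j : ℕ} (hj : j < 2)
    (h : (MGL t c j : GLm p 3) = 1) : t = 0 ∧ c = 0 ∧ j = 0 := by
  have hM := congrArg (fun g : GLm p 3 => (g : Mat p 3)) h
  simp only [coe_MGL, Units.val_one] at hM
  have h12 := congrFun (congrFun hM 1) 2
  have h02 := congrFun (congrFun hM 0) 2
  have h11 := congrFun (congrFun hM 1) 1
  simp [Mmat] at h12 h02 h11
  subst h12
  simp at h02
  refine ⟨rfl, h02, ?_⟩
  by_contra hj0
  have hj1 : j = 1 := by omega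
  subst hj1
  rw [sg, pow_one] at h11
  exact neg_one_ne_one hp2 h11

/-! ## The functional -/

/-- `L h = Σ_{t,c} Σ_{j<2} (-1)^j ψ(c) h(M(t,c,(-1)^j))`. -/
def L : (GLm p 3 → ℂ) →ₗ[ℂ] ℂ where
  toFun h := ∑ t : ZMod p, ∑ c : ZMod p, ∑ j : Fin 2,
    (-1 : ℂ) ^ (j : ℕ) * (ZMod.stdAddChar (N := p) c : ℂ) * h (MGL t c (j : ℕ))
  map_add' f g := by
    simp only [Pi.add_apply, mul_add, Finset.sum_add_distrib]
  map_smul' a f := by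
    simp only [Pi.smul_apply, smul_eq_mul, RingHom.id_apply, Finset.mul_sum, mul_left_comm]

/-- Unfolding `L`. -/
theorem L_apply (h : GLm p 3 → ℂ) : L h = ∑ t : ZMod p, ∑ c : ZMod p, ∑ j : Fin 2,
    (-1 : ℂ) ^ (j : ℕ) * (ZMod.stdAddChar (N := p) c : ℂ) * h (MGL t c (j : ℕ)) := rfl

/-- **THE SHIFT.**  For `u₂ ≠ 0`, `M(t + 2u₁/u₂, c, -1) u = M(t, c, 1) u`. -/
theorem shift_mulVec (hp2 : p ≠ 2) (t c : ZMod p) {u : Fin 3 → ZMod p} (hu : u 2 ≠ 0) :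
    ((MGL (t + 2 * u 1 * (u 2)⁻¹) c 1 : GLm p 3) : Mat p 3) *ᵥ u =
      ((MGL t c 0 : GLm p 3) : Mat p 3) *ᵥ u := by
  rw [MGL_mulVec, MGL_mulVec]
  have hδ : 2 * u 1 * (u 2)⁻¹ * u 2 = 2 * u 1 := by
    rw [mul_assoc, inv_mul_cancel₀ hu, mul_one]
  have h2 := two_mul_inv_two hp2
  simp only [sg, pow_one, pow_zero, one_mul]
  refine Matrix.vecCons_inj.mpr ⟨?_, Matrix.vecCons_inj.mpr ⟨?_, Matrix.vecCons_inj.mpr ⟨rfl, ?_⟩⟩⟩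
  · linear_combination (2 * 2⁻¹ * t + 2⁻¹ * (2 * u 1 * (u 2)⁻¹)) * hδ +
      (2 * t * u 1 + 2 * u 1 * (u 2)⁻¹ * u 1) * h2
  · linear_combination hδ
  · exact Subsingleton.elim _ _

/-- For `u₂ ≠ 0`, any function of `M(t,c,-1) u` summed over `t` equals the same for `M(t,c,1) u`. -/
theorem sum_shift (hp2 : p ≠ 2) (c : ZMod p) {u : Fin 3 → ZMod p} (hu : u 2 ≠ 0)
    (G : (Fin 3 → ZMod p) → ℂ) :
    (∑ t : ZMod p, G (((MGL t c 1 : GLm p 3) : Mat p 3) *ᵥ u)) =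
      ∑ t : ZMod p, G (((MGL t c 0 : GLm p 3) : Mat p 3) *ᵥ u) := by
  symm
  refine Fintype.sum_equiv (Equiv.addRight (2 * u 1 * (u 2)⁻¹)) _ _ fun t => ?_
  simp only [Equiv.coe_addRight]
  rw [shift_mulVec hp2 t c hu]

/-- **`L` kills every function of `g u`** (in particular every vector transport). -/
theorem L_orbital (hp2 : p ≠ 2) (u : Fin 3 → ZMod p) (G : (Fin 3 → ZMod p) → ℂ) :
    L (fun g : GLm p 3 => G ((g : Mat p 3) *ᵥ u)) = 0 := by
  rw [L_apply]
  by_cases hu : u 2 = 0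
  · -- the vector `M(t,c,e) u` does not see `c`
    refine Finset.sum_eq_zero fun t _ => ?_
    have key : ∀ (c : ZMod p) (j : ℕ), ((MGL t c j : GLm p 3) : Mat p 3) *ᵥ u =
        ![u 0 + sg j * t * u 1, sg j * u 1, 0] := by
      intro c j
      simp only [MGL_mulVec, hu, mul_zero, add_zero]
    simp_rw [key]
    rw [Finset.sum_comm]
    refine Finset.sum_eq_zero fun j _ => ?_
    have : ∀ c : ZMod p, (-1 : ℂ) ^ (j : ℕ) * (ZMod.stdAddChar (N := p) c : ℂ) *
        G ![u 0 + sg (p := p) j * t * u 1, sg (p := p) j * u 1, 0] =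
        (ZMod.stdAddChar (N := p) c : ℂ) * ((-1 : ℂ) ^ (j : ℕ) *
        G ![u 0 + sg (p := p) j * t * u 1, sg (p := p) j * u 1, 0]) := by
      intro c; ring
    simp_rw [this]
    rw [← Finset.sum_mul, sum_psi, zero_mul]
  · -- `u₂ ≠ 0`: for fixed `c` the `j = 0` and `j = 1` sums agree and the signs cancel
    rw [Finset.sum_comm]
    refine Finset.sum_eq_zero fun c _ => ?_
    rw [Finset.sum_comm, Fin.sum_univ_two]
    simp only [Fin.val_zero, Fin.val_one, pow_zero, pow_one, one_mul, ← Finset.mul_sum]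
    rw [sum_shift hp2 c hu G]
    ring

/-- **`L` kills every vector transport.** -/
theorem L_transport (hp2 : p ≠ 2) (u w : Fin 3 → ZMod p) :
    L (fun g : GLm p 3 => if (g : Mat p 3) *ᵥ u = w then (1 : ℂ) else 0) = 0 := by
  show L (fun g : GLm p 3 =>
    (fun v : Fin 3 → ZMod p => if v = w then (1 : ℂ) else 0) ((g : Mat p 3) *ᵥ u)) = 0
  generalize (fun v : Fin 3 → ZMod p => if v = w then (1 : ℂ) else 0) = G
  exact L_orbital hp2 u G

/-- **`L` of an identity test covering `K ∖ 1` is `1`.** -/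
theorem L_delta (hp2 : p ≠ 2) {h : GLm p 3 → ℂ} (h1 : h 1 = 1)
    (h0 : ∀ t c : ZMod p, ∀ j < 2, (MGL t c j : GLm p 3) ≠ 1 → h (MGL t c j) = 0) :
    L h = 1 := by
  rw [L_apply]
  have hval : ∀ (t c : ZMod p) (j : Fin 2), ¬ (t = 0 ∧ c = 0 ∧ (j : ℕ) = 0) →
      (-1 : ℂ) ^ (j : ℕ) * (ZMod.stdAddChar (N := p) c : ℂ) * h (MGL t c (j : ℕ)) = 0 := by
    intro t c j hne
    have hne' : (MGL t c (j : ℕ) : GLm p 3) ≠ 1 := fun heq => hne (MGL_eq_one hp2 j.isLt heq)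
    rw [h0 t c j j.isLt hne', mul_zero]
  rw [Finset.sum_eq_single (0 : ZMod p), Finset.sum_eq_single (0 : ZMod p),
    Finset.sum_eq_single (⟨0, by omega⟩ : Fin 2)]
  · have hM : (MGL (0 : ZMod p) 0 ((⟨0, by omega⟩ : Fin 2) : ℕ) : GLm p 3) = 1 := MGL_zero
    rw [hM, h1]
    simp
  · intro j _ hj
    exact hval 0 0 j fun ⟨_, _, h⟩ => hj (Fin.ext h)
  · intro h; exact absurd (Finset.mem_univ _) h
  · intro c _ hc
    exact Finset.sum_eq_zero fun j _ => hval 0 c j fun ⟨_, h, _⟩ => hc h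
  · intro h; exact absurd (Finset.mem_univ _) h
  · intro t _ ht
    exact Finset.sum_eq_zero fun c _ => Finset.sum_eq_zero fun j _ =>
      hval t c j fun ⟨h, _, _⟩ => ht h
  · intro h; exact absurd (Finset.mem_univ _) h

/-! ## The exclusions -/

variable {H₁ H₂ H₃ : Subgroup (GLm p 3)}

/-- **COVER FORM.**  If every `M(t,c,(-1)^j) ≠ 1` is a triple product `a' b' c'`
(`a' ∈ H₁, b' ∈ H₂, c' ∈ H₃`), there is no level-one identity design (`p` odd, `m = 3`, every `ε`,
no TPP). -/
theorem no_design_of_cover (hp2 : p ≠ 2)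
    (hcov : ∀ t c : ZMod p, ∀ j < 2, (MGL t c j : GLm p 3) ≠ 1 →
      ∃ a' ∈ H₁, ∃ b' ∈ H₂, ∃ c' ∈ H₃, a' * b' * c' = MGL t c j) :
    ¬ ∃ c : Mat p 3 → ℂ, (∀ M, 1 < M.rank → c M = 0) ∧
      (∑ M, c M * ZMod.stdAddChar (Matrix.trace (M * ((1 : GLm p 3) : Mat p 3)))) = 1 ∧
      ∀ a ∈ H₁, ∀ b ∈ H₂, ∀ g ∈ H₃, a * b * g ≠ 1 →
        (∑ M, c M * ZMod.stdAddChar (Matrix.trace (M * ((a * b * g : GLm p 3) : Mat p 3)))) = 0 := by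
  intro hdes
  obtain ⟨f, hf, h1, h0⟩ := exists_test hdes
  have hker : levelSubmodule p 3 1 ≤ LinearMap.ker (L (p := p)) :=
    levelSubmodule_le_of_transport fun u w => by
      rw [LinearMap.mem_ker]
      exact L_transport hp2 u w
  have hz : L f = 0 := LinearMap.mem_ker.mp (hker hf)
  have h0' : ∀ t c : ZMod p, ∀ j < 2, (MGL t c j : GLm p 3) ≠ 1 → f (MGL t c j) = 0 := by
    intro t c j hj hne
    obtain ⟨a', ha, b', hb, c', hc, habc⟩ := hcov t c j hj hne
    rw [← habc]
    exact h0 a' ha b' hb c' hc (habc ▸ hne)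
  have hone := L_delta hp2 h1 h0'
  rw [hz] at hone
  exact zero_ne_one hone

/-- **`K = D_{2p} × X₁₃` LIES IN NO MEMBER** (`|K| = 2p²` is in the member window):
`{M(t,c,±1)} ⊆ H₁` ⇒ no level-one identity design. -/
theorem no_design_same₁ (hp2 : p ≠ 2) (hK : ∀ t c : ZMod p, ∀ j < 2, (MGL t c j : GLm p 3) ∈ H₁) :
    ¬ ∃ c : Mat p 3 → ℂ, (∀ M, 1 < M.rank → c M = 0) ∧
      (∑ M, c M * ZMod.stdAddChar (Matrix.trace (M * ((1 : GLm p 3) : Mat p 3)))) = 1 ∧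
      ∀ a ∈ H₁, ∀ b ∈ H₂, ∀ g ∈ H₃, a * b * g ≠ 1 →
        (∑ M, c M * ZMod.stdAddChar (Matrix.trace (M * ((a * b * g : GLm p 3) : Mat p 3)))) = 0 :=
  no_design_of_cover hp2 fun t c j hj _ =>
    ⟨MGL t c j, hK t c j hj, 1, H₂.one_mem, 1, H₃.one_mem, by rw [mul_one, mul_one]⟩

/-- `M(t,c,e) = M(t,0,e) · M(0,c,1)` (dihedral part times root part). -/
theorem MGL_eq_D_mul_X (hp2 : p ≠ 2) (t c : ZMod p) (j : ℕ) :
    (MGL t c j : GLm p 3) = MGL t 0 j * MGL 0 c 0 := by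
  apply Units.ext
  simp only [Units.val_mul, coe_MGL]
  rw [show sg (p := p) 0 = 1 from pow_zero _, Mmat_mul hp2 _ _ _ _ _ _ (sg_mul_sg j)]
  simp

/-- `M(t,c,e) = M(0,c,1) · M(t,0,e)` (the root part is central). -/
theorem MGL_eq_X_mul_D (hp2 : p ≠ 2) (t c : ZMod p) (j : ℕ) :
    (MGL t c j : GLm p 3) = MGL 0 c 0 * MGL t 0 j := by
  apply Units.ext
  simp only [Units.val_mul, coe_MGL]
  rw [show sg (p := p) 0 = 1 from pow_zero _, Mmat_mul hp2 _ _ _ _ _ _ (one_mul 1)]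
  simp

/-- **`D_{2p} = ⟨J₃, s'⟩ ≤ H₁` and `X₁₃ ≤ H₂`** ⇒ no level-one identity design. -/
theorem no_design_DX₁₂ (hp2 : p ≠ 2) (hD : ∀ t : ZMod p, ∀ j < 2, (MGL t 0 j : GLm p 3) ∈ H₁)
    (hX : ∀ c : ZMod p, (MGL 0 c 0 : GLm p 3) ∈ H₂) :
    ¬ ∃ c : Mat p 3 → ℂ, (∀ M, 1 < M.rank → c M = 0) ∧
      (∑ M, c M * ZMod.stdAddChar (Matrix.trace (M * ((1 : GLm p 3) : Mat p 3)))) = 1 ∧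
      ∀ a ∈ H₁, ∀ b ∈ H₂, ∀ g ∈ H₃, a * b * g ≠ 1 →
        (∑ M, c M * ZMod.stdAddChar (Matrix.trace (M * ((a * b * g : GLm p 3) : Mat p 3)))) = 0 :=
  no_design_of_cover hp2 fun t c j hj _ =>
    ⟨MGL t 0 j, hD t j hj, MGL 0 c 0, hX c, 1, H₃.one_mem, by rw [mul_one, ← MGL_eq_D_mul_X hp2]⟩

/-- **`X₁₃ ≤ H₁` and `D_{2p} ≤ H₂`** ⇒ no level-one identity design. -/
theorem no_design_XD₁₂ (hp2 : p ≠ 2) (hX : ∀ c : ZMod p, (MGL 0 c 0 : GLm p 3) ∈ H₁)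
    (hD : ∀ t : ZMod p, ∀ j < 2, (MGL t 0 j : GLm p 3) ∈ H₂) :
    ¬ ∃ c : Mat p 3 → ℂ, (∀ M, 1 < M.rank → c M = 0) ∧
      (∑ M, c M * ZMod.stdAddChar (Matrix.trace (M * ((1 : GLm p 3) : Mat p 3)))) = 1 ∧
      ∀ a ∈ H₁, ∀ b ∈ H₂, ∀ g ∈ H₃, a * b * g ≠ 1 →
        (∑ M, c M * ZMod.stdAddChar (Matrix.trace (M * ((a * b * g : GLm p 3) : Mat p 3)))) = 0 :=
  no_design_of_cover hp2 fun t c j hj _ =>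
    ⟨MGL 0 c 0, hX c, MGL t 0 j, hD t j hj, 1, H₃.one_mem, by rw [mul_one, ← MGL_eq_X_mul_D hp2]⟩

/-- **`D_{2p} ≤ H₁` and `X₁₃ ≤ H₃`** ⇒ no level-one identity design. -/
theorem no_design_DX₁₃ (hp2 : p ≠ 2) (hD : ∀ t : ZMod p, ∀ j < 2, (MGL t 0 j : GLm p 3) ∈ H₁)
    (hX : ∀ c : ZMod p, (MGL 0 c 0 : GLm p 3) ∈ H₃) :
    ¬ ∃ c : Mat p 3 → ℂ, (∀ M, 1 < M.rank → c M = 0) ∧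
      (∑ M, c M * ZMod.stdAddChar (Matrix.trace (M * ((1 : GLm p 3) : Mat p 3)))) = 1 ∧
      ∀ a ∈ H₁, ∀ b ∈ H₂, ∀ g ∈ H₃, a * b * g ≠ 1 →
        (∑ M, c M * ZMod.stdAddChar (Matrix.trace (M * ((a * b * g : GLm p 3) : Mat p 3)))) = 0 :=
  no_design_of_cover hp2 fun t c j hj _ =>
    ⟨MGL t 0 j, hD t j hj, 1, H₂.one_mem, MGL 0 c 0, hX c, by rw [mul_one, ← MGL_eq_D_mul_X hp2]⟩

end DihedralRoot
end Summit.MatrixMultiplication.MatrixMultiplication.Theorems.SubgroupIdentityDesigns.Negative
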